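import Literature.Analysis.OperatorTheory.PositiveKernelTransferOperator
import HarnessLib

/-!
# Powers of the `L²` transfer operator versus iterates of the pointwise kernel operator

Topic `Literature/Analysis/OperatorTheory`; companion of `PositiveKernelTransferOperator.lean` (the
bounded operator `A` on `Lp ℝ 2 μ` with `A φ =ᵐ ∫ K(·, y) φ(y) dμ(y)`), `KernelPathIntegralPeeling.lean`
(block integrals = iterates of the POINTWISE operator `(κ f)(x) = ∫ K(x, y) f(y) dμ(y)` on bounded
measurable functions) and `PowerIterationRatioLimit.lean` (which speaks about `⟪Aⁿ k_u, ·⟫`). This file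
PROVES the bridge between the two languages, for a bounded strongly measurable kernel on a finite
measure space:

* `exists_bound_and_measurable_kernelIterate` — `κ` preserves "bounded and measurable", so all
  iterates `κ^[j] h` of a bounded measurable `h` are bounded and measurable (hence in `L²`);
* `pow_kernelOp_toLp_ae_eq_iterate` — `A^j [h] =ᵐ κ^[j] h` (`[h]` the `L²` class of `h`);
* `inner_kernel_section_pow_kernelOp` — for a SYMMETRIC kernel, `⟪k_u, A^j [h]⟫ = (κ^[j+1] h)(u)` for
  EVERY boundary point `u` (`k_u = K(u, ·)`): the last integration against the kernel section is an
  honest integral, so no null set in the boundary variable appears.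

Mathlib + `PositiveKernelTransferOperator.lean` only; no definitions (`κ` is written out). [folklore]
-/

noncomputable section

open MeasureTheory Set Filter Function
open scoped RealInnerProductSpace ENNReal

namespace Literature.Analysis.OperatorTheory

variable {X : Type*} [MeasurableSpace X] {μ : Measure X} [IsFiniteMeasure μ]
  {K : X → X → ℝ} {C : ℝ}

/-- `κ f = ∫ K(·, y) f(y) dμ(y)` of a bounded measurable `f` is bounded (by `C μ(X) B`) and
measurable; hence every iterate `κ^[j] h` of a bounded measurable `h` is bounded and measurable.
[folklore] -/
theorem exists_bound_and_measurable_kernelIterate (hK : StronglyMeasurable (uncurry K))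
    (hC : ∀ x y, ‖K x y‖ ≤ C) {h : X → ℝ} (hh : Measurable h) (hhb : ∃ B, ∀ x, ‖h x‖ ≤ B) (j : ℕ) :
    (∃ B, ∀ x, ‖((fun f : X → ℝ => fun x => ∫ y, K x y * f y ∂μ)^[j] h) x‖ ≤ B) ∧
      StronglyMeasurable ((fun f : X → ℝ => fun x => ∫ y, K x y * f y ∂μ)^[j] h) := by
  induction j with
  | zero => exact ⟨hhb, hh.stronglyMeasurable⟩
  | succ j ih =>
    obtain ⟨⟨B, hB⟩, hm⟩ := ih
    set g := (fun f : X → ℝ => fun x => ∫ y, K x y * f y ∂μ)^[j] h with hg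
    rw [Function.iterate_succ_apply', ← hg]
    refine ⟨⟨C * (B * μ.real univ), fun x => ?_⟩, ?_⟩
    · calc ‖∫ y, K x y * g y ∂μ‖ ≤ ∫ y, ‖K x y * g y‖ ∂μ := norm_integral_le_integral_norm _
        _ ≤ ∫ _y, C * B ∂μ := by
            refine integral_mono_of_nonneg (Eventually.of_forall fun y => norm_nonneg _)
              (integrable_const _) (Eventually.of_forall fun y => ?_)
            dsimp only
            rw [norm_mul]
            exact mul_le_mul (hC x y) (hB y) (norm_nonneg _) ((norm_nonneg _).trans (hC x y))
        _ = C * (B * μ.real univ) := by rw [integral_const, smul_eq_mul]; ring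
    · exact (hK.mul (hm.comp_measurable measurable_snd)).integral_prod_right'

/-- For a bounded measurable `h`, the class `[h] ∈ L²`. [folklore] -/
theorem memLp_two_of_bound {h : X → ℝ} (hh : Measurable h) {B : ℝ} (hhb : ∀ x, ‖h x‖ ≤ B) :
    MemLp h 2 μ :=
  MemLp.of_bound hh.aestronglyMeasurable B (Eventually.of_forall hhb)

variable {A : Lp ℝ 2 μ →L[ℝ] Lp ℝ 2 μ}

/-- **`A^j [h] = κ^[j] h` almost everywhere**: the powers of the `L²` transfer operator act on the
class of a bounded measurable `h` as the iterates of the pointwise kernel operator. [folklore] -/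
theorem pow_kernelOp_toLp_ae_eq_iterate
    (hA : ∀ φ : Lp ℝ 2 μ, (A φ : X → ℝ) =ᵐ[μ] fun x => ∫ y, K x y * φ y ∂μ)
    {h : X → ℝ} (hh : Measurable h) {B : ℝ} (hhb : ∀ x, ‖h x‖ ≤ B) (j : ℕ) :
    ((A ^ j) ((memLp_two_of_bound (μ := μ) hh hhb).toLp h) : X → ℝ) =ᵐ[μ]
      (fun f : X → ℝ => fun x => ∫ y, K x y * f y ∂μ)^[j] h := by
  induction j with
  | zero =>
    simp only [pow_zero, one_apply_eq_self, Function.iterate_zero, id_eq]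
    exact (memLp_two_of_bound hh hhb).coeFn_toLp
  | succ j ih =>
    rw [pow_succ', mul_apply_eq_comp, Function.iterate_succ_apply']
    filter_upwards [hA ((A ^ j) ((memLp_two_of_bound (μ := μ) hh hhb).toLp h))] with x hx
    rw [hx]
    exact integral_congr_ae (by filter_upwards [ih] with y hy; rw [hy])

/-- **`⟪k_u, A^j [h]⟫ = (κ^[j+1] h)(u)` for every `u`** (symmetric kernel): pairing with the kernel
section `k_u = K(u, ·)` performs one more, honest, kernel integration. [folklore] -/
theorem inner_kernel_section_pow_kernelOp (hK : StronglyMeasurable (uncurry K))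
    (hC : ∀ x y, ‖K x y‖ ≤ C) (hsymm : ∀ x y, K x y = K y x)
    (hA : ∀ φ : Lp ℝ 2 μ, (A φ : X → ℝ) =ᵐ[μ] fun x => ∫ y, K x y * φ y ∂μ)
    {h : X → ℝ} (hh : Measurable h) {B : ℝ} (hhb : ∀ x, ‖h x‖ ≤ B) (j : ℕ) (u : X) :
    ⟪(memLp_kernel_section (μ := μ) hK hC u).toLp (K u),
        (A ^ j) ((memLp_two_of_bound (μ := μ) hh hhb).toLp h)⟫ =
      ((fun f : X → ℝ => fun x => ∫ y, K x y * f y ∂μ)^[j + 1] h) u := by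
  rw [real_inner_comm, inner_kernel_section hK hC, Function.iterate_succ_apply']
  refine integral_congr_ae ?_
  filter_upwards [pow_kernelOp_toLp_ae_eq_iterate hA hh hhb j] with y hy
  rw [hy, hsymm u y, mul_comm]

end Literature.Analysis.OperatorTheory

end
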